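import Literature.NumberTheory.Weil1964.ArchFollandCoordinates
import Literature.NumberTheory.Automorphic.AdelicSchwartzBruhatDirectSum
import Literature.Analysis.SegalBargmann.SchwartzTensorSchurProjective
import HarnessLib

/-!
# The archimedean two-factor theorem: `A (Φ₁ ⊠ Φ₂) = c_∞ • (A₁ Φ₁ ⊠ A₂ Φ₂)` for implementers of a see-saw pair

Origin: `pub-hodgecm` MODEL-CONSTRUCTION sub-cell, node W2-⊗ (⊗S)-𝔸 (iii)(d1b), second half. KERNEL MATHEMATICS ONLY:
no `def … : Prop` records, no `axiom`, no proof hole.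

For a number field `F`, index types `ι₁, ι₂`, adelic Gram matrices `T₁, T₂` and `T = fromBlocks T₁ 0 0 T₂` on `ι₁ ⊕ ι₂`,
implementing pairs `(G, M)`, `(g₁, M₁)`, `(g₂, M₂)` on the global Schrödinger representations (`Implements ρ (ofSymplectic ·) ·`)
with `G` block-diagonal (`hg`, the shape of `UnitaryGroup.spSumEquiv_apply`) and tensor decompositions
`M = A ⊗ M_f`, `M_j = A_j ⊗ M_{f,j}` on pure tensors (`A, A_j` CONTINUOUS linear automorphisms of the archimedean
Schwartz spaces — the output of `exists_continuousLinearEquiv_of_mem_adelicMpCont`), this file proves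

  **`arch_two_factor`**: `∃ c ≠ 0, ∀ Φ₁ Φ₂, A (archBoxTensor Φ₁ Φ₂) = c • archBoxTensor (A₁ Φ₁) (A₂ Φ₂)`.

Route: §1 everything SPLITS over `Sum.elim` (archimedean vectors, `archMat (fromBlocks …)`, the trace pairing, Folland
frequencies in the coordinates `sumCarrierEquiv b` / `piCarrierEquiv b ι_j` of a real basis `b` of `F ⊗ ℝ`, the
archimedean action `archAct`, and — additivity of Weil's quadratic character over an orthogonal sum — the cocycle
`follandCocycle`); §2 hence the archimedean factor `A` is projectively covariant over `blockPhase s₁ s₂` with cocycle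
`blockChar χ₁ χ₂` (`s_j = archPhaseMap`, `χ_j = archCocycle` of `ArchFollandCoordinates`), and
`SegalBargmann.exists_ne_zero_smul_piBoxTensor_proj` applies (`piBoxTensor = archBoxTensor` definitionally).

## References
* [Weil1964] A. Weil, *Sur certains groupes d'opérateurs unitaires*, Acta Math. 111 (1964), n° 4–5, n° 37–38.
* [Folland1989] G. B. Folland, *Harmonic Analysis in Phase Space*, Princeton UP (1989), Prop. (1.43), §1.7.
* [MoeglinVignerasWaldspurger1987] Chap. 2 II.1 (A).

## Provenance

LEAN-IN-TREE rule (2026-08-18), pub-hodgecm model-construction sub-cell, seat mc-binder-2 gen 3 ((⊗S)-𝔸 (iii)(d1b);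
consumer: the (iii) assembly `AdelicMetaplecticTensorSchur` of seat mc-weil-2 gen 3).
-/

set_option autoImplicit false

noncomputable section

open scoped Matrix SchwartzMap TensorProduct Real Classical
open Complex NumberField NumberField.mixedEmbedding IsDedekindDomain
open Literature.NumberTheory.Automorphic Literature.RepresentationTheory.HeisenbergGroup
open Literature.Analysis.SegalBargmann

namespace Literature.NumberTheory.Weil1964

variable {F : Type} [Field F] [NumberField F] {ι₁ ι₂ : Type}

/-! ## §1 Splitting over `Sum.elim` -/

section Split

/-- Archimedean vectors on `ι₁ ⊕ ι₂` split. [folklore] -/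
theorem archVec_sumElim (a₁ : ι₁ → mixedSpace F) (a₂ : ι₂ → mixedSpace F) :
    archVec F (ι₁ ⊕ ι₂) (Sum.elim a₁ a₂) = Sum.elim (archVec F ι₁ a₁) (archVec F ι₂ a₂) := by
  funext i; cases i <;> rfl

/-- Archimedean parts on `ι₁ ⊕ ι₂` split. [folklore] -/
theorem piArch_sumElim (x₁ : ι₁ → AdeleRing (𝓞 F) F) (x₂ : ι₂ → AdeleRing (𝓞 F) F) :
    piArch F (ι₁ ⊕ ι₂) (Sum.elim x₁ x₂) = Sum.elim (piArch F ι₁ x₁) (piArch F ι₂ x₂) := by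
  funext i; cases i <;> rfl

variable [Fintype ι₁] [Fintype ι₂]

/-- `(0 : 𝔸_F).1 = 0` (the adele ring is a `def`, so `Prod.fst_zero` does not fire syntactically). [folklore] -/
theorem adele_fst_zero : ((0 : AdeleRing (𝓞 F) F).1 : InfiniteAdeleRing F) = 0 := rfl

omit [Fintype ι₁] [Fintype ι₂] in
/-- The archimedean part of a block-diagonal adelic matrix is block-diagonal. [folklore] -/
theorem archMat_fromBlocks (T₁ : Matrix ι₁ ι₁ (AdeleRing (𝓞 F) F)) (T₂ : Matrix ι₂ ι₂ (AdeleRing (𝓞 F) F)) :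
    archMat F (ι₁ ⊕ ι₂) (Matrix.fromBlocks T₁ 0 0 T₂) = Matrix.fromBlocks (archMat F ι₁ T₁) 0 0 (archMat F ι₂ T₂) := by
  funext i j
  rcases i with i | i <;> rcases j with j | j <;>
    simp only [archMat, Matrix.fromBlocks_apply₁₁, Matrix.fromBlocks_apply₁₂, Matrix.fromBlocks_apply₂₁,
      Matrix.fromBlocks_apply₂₂, Matrix.zero_apply, adele_fst_zero, map_zero]

/-- Block-diagonal matrices act blockwise on `Sum.elim` vectors. [folklore] -/
theorem fromBlocks_diag_mulVec_sumElim {R : Type*} [NonUnitalNonAssocSemiring R] (A : Matrix ι₁ ι₁ R)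
    (D : Matrix ι₂ ι₂ R) (x : ι₁ → R) (y : ι₂ → R) :
    Matrix.fromBlocks A 0 0 D *ᵥ Sum.elim x y = Sum.elim (A *ᵥ x) (D *ᵥ y) := by
  rw [Matrix.fromBlocks_mulVec, Sum.elim_comp_inl, Sum.elim_comp_inr, Matrix.zero_mulVec, Matrix.zero_mulVec,
    add_zero, zero_add]

/-- The trace pairing on `ι₁ ⊕ ι₂` splits. [folklore] -/
theorem piTracePairing_sumElim (u₁ w₁ : ι₁ → mixedSpace F) (u₂ w₂ : ι₂ → mixedSpace F) :
    piTracePairing F (ι₁ ⊕ ι₂) (Sum.elim u₁ u₂) (Sum.elim w₁ w₂) =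
      piTracePairing F ι₁ u₁ w₁ + piTracePairing F ι₂ u₂ w₂ := by
  simp only [piTracePairing_apply, Fintype.sum_sum_type, Sum.elim_inl, Sum.elim_inr]

variable {τ : Type*} [Fintype τ] (b : Module.Basis τ ℝ (mixedSpace F))

/-- The sum coordinates on `Sum.elim` vectors. [folklore] -/
theorem sumCarrierEquiv_sumElim (x₁ : ι₁ → mixedSpace F) (x₂ : ι₂ → mixedSpace F) :
    sumCarrierEquiv b ι₁ ι₂ (Sum.elim x₁ x₂) = Sum.elim (piCarrierEquiv b ι₁ x₁) (piCarrierEquiv b ι₂ x₂) := by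
  funext k
  rcases k with ⟨i, t⟩ | ⟨j, t⟩
  · rw [sumCarrierEquiv_apply_inl, Sum.elim_inl, Sum.elim_inl, piCarrierEquiv_apply]
  · rw [sumCarrierEquiv_apply_inr, Sum.elim_inr, Sum.elim_inr, piCarrierEquiv_apply]

omit [Fintype ι₁] [Fintype ι₂] [Fintype τ] in
/-- `Sum.elim (δ_k) 0 = δ_{inl k}` (for ANY decidability instances — the ones met after unfolding may be classical).
[folklore] -/
theorem sumElim_single_zero {d₁ : DecidableEq (ι₁ × τ)} {d : DecidableEq ((ι₁ × τ) ⊕ (ι₂ × τ))} (k : ι₁ × τ) :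
    Sum.elim (@Pi.single _ _ _ d₁ k (1 : ℝ)) (0 : ι₂ × τ → ℝ) = @Pi.single _ _ _ d (Sum.inl k) (1 : ℝ) := by
  funext j
  rcases j with j | j <;> simp [Pi.single_apply]

omit [Fintype ι₁] [Fintype ι₂] [Fintype τ] in
/-- `Sum.elim 0 (δ_k) = δ_{inr k}` (any decidability instances). [folklore] -/
theorem sumElim_zero_single {d₂ : DecidableEq (ι₂ × τ)} {d : DecidableEq ((ι₁ × τ) ⊕ (ι₂ × τ))} (k : ι₂ × τ) :
    Sum.elim (0 : ι₁ × τ → ℝ) (@Pi.single _ _ _ d₂ k (1 : ℝ)) = @Pi.single _ _ _ d (Sum.inr k) (1 : ℝ) := by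
  funext j
  rcases j with j | j <;> simp [Pi.single_apply]

/-- The inverse sum coordinates of a coordinate vector in the first block (any decidability instances). [folklore] -/
theorem sumCarrierEquiv_symm_single_inl {d₁ : DecidableEq (ι₁ × τ)} {d : DecidableEq ((ι₁ × τ) ⊕ (ι₂ × τ))}
    (k : ι₁ × τ) :
    (sumCarrierEquiv b ι₁ ι₂).symm (@Pi.single _ _ _ d (Sum.inl k) (1 : ℝ)) =
      Sum.elim ((piCarrierEquiv b ι₁).symm (@Pi.single _ _ _ d₁ k (1 : ℝ))) (0 : ι₂ → mixedSpace F) := by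
  apply (sumCarrierEquiv b ι₁ ι₂).injective
  rw [ContinuousLinearEquiv.apply_symm_apply, sumCarrierEquiv_sumElim, ContinuousLinearEquiv.apply_symm_apply,
    map_zero, sumElim_single_zero]

/-- The inverse sum coordinates of a coordinate vector in the second block (any decidability instances). [folklore] -/
theorem sumCarrierEquiv_symm_single_inr {d₂ : DecidableEq (ι₂ × τ)} {d : DecidableEq ((ι₁ × τ) ⊕ (ι₂ × τ))}
    (k : ι₂ × τ) :
    (sumCarrierEquiv b ι₁ ι₂).symm (@Pi.single _ _ _ d (Sum.inr k) (1 : ℝ)) =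
      Sum.elim (0 : ι₁ → mixedSpace F) ((piCarrierEquiv b ι₂).symm (@Pi.single _ _ _ d₂ k (1 : ℝ))) := by
  apply (sumCarrierEquiv b ι₁ ι₂).injective
  rw [ContinuousLinearEquiv.apply_symm_apply, sumCarrierEquiv_sumElim, ContinuousLinearEquiv.apply_symm_apply,
    map_zero, sumElim_zero_single]

/-- **Folland frequencies split**: in the sum coordinates the frequency vector of `Sum.elim w₁ w₂` is `Sum.elim` of
the two frequency vectors. [folklore] -/
theorem follandFreq_sumElim (w₁ : ι₁ → mixedSpace F) (w₂ : ι₂ → mixedSpace F) :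
    follandFreq F (ι₁ ⊕ ι₂) (sumCarrierEquiv b ι₁ ι₂) (Sum.elim w₁ w₂) =
      Sum.elim (follandFreq F ι₁ (piCarrierEquiv b ι₁) w₁) (follandFreq F ι₂ (piCarrierEquiv b ι₂) w₂) := by
  funext k
  rcases k with k | k
  · rw [Sum.elim_inl]
    simp only [follandFreq]
    rw [sumCarrierEquiv_symm_single_inl, piTracePairing_sumElim, (piTracePairing F ι₂).map_zero, LinearMap.zero_apply,
      add_zero]
  · rw [Sum.elim_inr]
    simp only [follandFreq]
    rw [sumCarrierEquiv_symm_single_inr, piTracePairing_sumElim, (piTracePairing F ι₁).map_zero, LinearMap.zero_apply,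
      zero_add]

variable (T₁ : Matrix ι₁ ι₁ (AdeleRing (𝓞 F) F)) (T₂ : Matrix ι₂ ι₂ (AdeleRing (𝓞 F) F))

/-- **Folland coordinates split**: `Ξ_T (Sum.elim a₁ a₂, Sum.elim w₁ w₂) = (Sum.elim p₁ p₂, Sum.elim q₁ q₂)` with
`(p_j, q_j) = Ξ_{T_j} (a_j, w_j)`. [folklore] -/
theorem archFolland_sumElim (a₁ w₁ : ι₁ → mixedSpace F) (a₂ w₂ : ι₂ → mixedSpace F) :
    archFolland (Matrix.fromBlocks T₁ 0 0 T₂) (sumCarrierEquiv b ι₁ ι₂) (Sum.elim a₁ a₂, Sum.elim w₁ w₂) =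
      (Sum.elim (archFolland T₁ (piCarrierEquiv b ι₁) (a₁, w₁)).1 (archFolland T₂ (piCarrierEquiv b ι₂) (a₂, w₂)).1,
        Sum.elim (archFolland T₁ (piCarrierEquiv b ι₁) (a₁, w₁)).2
          (archFolland T₂ (piCarrierEquiv b ι₂) (a₂, w₂)).2) := by
  simp only [archFolland_apply, archMat_fromBlocks, fromBlocks_diag_mulVec_sumElim, sumCarrierEquiv_sumElim,
    follandFreq_sumElim]

variable [DecidableEq ι₁] [DecidableEq ι₂]
variable (G : symplecticGroup (polar (adelicForm F (ι₁ ⊕ ι₂) (Matrix.fromBlocks T₁ 0 0 T₂))))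
  (g₁ : symplecticGroup (polar (adelicForm F ι₁ T₁))) (g₂ : symplecticGroup (polar (adelicForm F ι₂ T₂)))
  (hg : ∀ (x₁ y₁ : ι₁ → AdeleRing (𝓞 F) F) (x₂ y₂ : ι₂ → AdeleRing (𝓞 F) F),
    G.1 (Sum.elim x₁ x₂, Sum.elim y₁ y₂) =
      (Sum.elim (g₁.1 (x₁, y₁)).1 (g₂.1 (x₂, y₂)).1, Sum.elim (g₁.1 (x₁, y₁)).2 (g₂.1 (x₂, y₂)).2))

include hg in
/-- **The archimedean action of a block-diagonal `G` splits.** [folklore] -/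
theorem archAct_sumElim (a₁ w₁ : ι₁ → mixedSpace F) (a₂ w₂ : ι₂ → mixedSpace F) :
    archAct (Matrix.fromBlocks T₁ 0 0 T₂) G (Sum.elim a₁ a₂, Sum.elim w₁ w₂) =
      (Sum.elim (archAct T₁ g₁ (a₁, w₁)).1 (archAct T₂ g₂ (a₂, w₂)).1,
        Sum.elim (archAct T₁ g₁ (a₁, w₁)).2 (archAct T₂ g₂ (a₂, w₂)).2) := by
  simp only [archAct, archVec_sumElim, hg, piArch_sumElim]

include hg in
/-- **Weil's cocycle phase is multiplicative over the orthogonal sum**: the quadratic character `f_G` of a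
block-diagonal `G` for `T = T₁ ⊕ T₂` is `f_{g₁} + f_{g₂}`. [cite: Weil1964, n° 5, pp. 150–151] -/
theorem weilPhase_sumElim (a₁ w₁ : ι₁ → mixedSpace F) (a₂ w₂ : ι₂ → mixedSpace F) :
    weilPhase (Matrix.fromBlocks T₁ 0 0 T₂) G (Sum.elim a₁ a₂, Sum.elim w₁ w₂) =
      weilPhase T₁ g₁ (a₁, w₁) * weilPhase T₂ g₂ (a₂, w₂) := by
  rw [weilPhase, weilPhase, weilPhase, ← Circle.coe_mul, ← AddChar.map_add_eq_mul]
  congr 2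
  simp only [ofSymplectic_f, polar_apply, adelicForm_apply, archVec_sumElim, hg, fromBlocks_diag_mulVec_sumElim,
    sumElim_dotProduct_sumElim]
  ring

include hg in
/-- **The Folland cocycle is multiplicative over the orthogonal sum.** [folklore] -/
theorem follandCocycle_sumElim (a₁ w₁ : ι₁ → mixedSpace F) (a₂ w₂ : ι₂ → mixedSpace F) :
    follandCocycle (Matrix.fromBlocks T₁ 0 0 T₂) (sumCarrierEquiv b ι₁ ι₂) G (Sum.elim a₁ a₂, Sum.elim w₁ w₂) =
      follandCocycle T₁ (piCarrierEquiv b ι₁) g₁ (a₁, w₁) *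
        follandCocycle T₂ (piCarrierEquiv b ι₂) g₂ (a₂, w₂) := by
  have hX : ∀ (c₁ v₁ : ι₁ → mixedSpace F) (c₂ v₂ : ι₂ → mixedSpace F),
      sumCarrierEquiv b ι₁ ι₂ (Sum.elim c₁ c₂) ⬝ᵥ
          follandFreq F (ι₁ ⊕ ι₂) (sumCarrierEquiv b ι₁ ι₂)
            (archMat F (ι₁ ⊕ ι₂) (Matrix.fromBlocks T₁ 0 0 T₂) *ᵥ Sum.elim v₁ v₂) =
        piCarrierEquiv b ι₁ c₁ ⬝ᵥ follandFreq F ι₁ (piCarrierEquiv b ι₁) (archMat F ι₁ T₁ *ᵥ v₁) +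
          piCarrierEquiv b ι₂ c₂ ⬝ᵥ follandFreq F ι₂ (piCarrierEquiv b ι₂) (archMat F ι₂ T₂ *ᵥ v₂) := by
    intro c₁ v₁ c₂ v₂
    rw [archMat_fromBlocks, fromBlocks_diag_mulVec_sumElim, sumCarrierEquiv_sumElim, follandFreq_sumElim,
      sumElim_dotProduct_sumElim]
  rw [follandCocycle, follandCocycle, follandCocycle, weilPhase_sumElim T₁ T₂ G g₁ g₂ hg,
    archAct_sumElim T₁ T₂ G g₁ g₂ hg, hX, hX]
  push_cast
  simp only [neg_add, mul_add, add_mul, Complex.exp_add]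
  ring

end Split

/-! ## §2 The archimedean two-factor theorem -/

section TwoFactor

variable [Fintype ι₁] [Fintype ι₂] [DecidableEq ι₁] [DecidableEq ι₂]
variable {τ : Type*} [Fintype τ] (b : Module.Basis τ ℝ (mixedSpace F))
variable (T₁ : Matrix ι₁ ι₁ (AdeleRing (𝓞 F) F)) (T₂ : Matrix ι₂ ι₂ (AdeleRing (𝓞 F) F))
  (hT₁ : IsUnit (archMat F ι₁ T₁)) (hT₂ : IsUnit (archMat F ι₂ T₂))
variable (G : symplecticGroup (polar (adelicForm F (ι₁ ⊕ ι₂) (Matrix.fromBlocks T₁ 0 0 T₂))))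
  (g₁ : symplecticGroup (polar (adelicForm F ι₁ T₁))) (g₂ : symplecticGroup (polar (adelicForm F ι₂ T₂)))
  (hg : ∀ (x₁ y₁ : ι₁ → AdeleRing (𝓞 F) F) (x₂ y₂ : ι₂ → AdeleRing (𝓞 F) F),
    G.1 (Sum.elim x₁ x₂, Sum.elim y₁ y₂) =
      (Sum.elim (g₁.1 (x₁, y₁)).1 (g₂.1 (x₂, y₂)).1, Sum.elim (g₁.1 (x₁, y₁)).2 (g₂.1 (x₂, y₂)).2))
-- the big implementer and its tensor shape
variable (M : piSchwartzBruhat F (ι₁ ⊕ ι₂) ≃ₗ[ℂ] piSchwartzBruhat F (ι₁ ⊕ ι₂))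
  (hM : Implements (adelicSchrodinger F (ι₁ ⊕ ι₂) (Matrix.fromBlocks T₁ 0 0 T₂))
    (ofSymplectic (polar (adelicForm F (ι₁ ⊕ ι₂) (Matrix.fromBlocks T₁ 0 0 T₂))) G) M)
  (A : 𝓢((ι₁ ⊕ ι₂ → mixedSpace F), ℂ) ≃L[ℂ] 𝓢((ι₁ ⊕ ι₂ → mixedSpace F), ℂ))
  (Mf : FinSB F (ι₁ ⊕ ι₂) →ₗ[ℂ] FinSB F (ι₁ ⊕ ι₂))
  (hAM : ∀ (Φ : 𝓢((ι₁ ⊕ ι₂ → mixedSpace F), ℂ)) (f : FinSB F (ι₁ ⊕ ι₂)),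
    M (piSchwartzBruhatEquiv F (ι₁ ⊕ ι₂) (Φ ⊗ₜ f)) = piSchwartzBruhatEquiv F (ι₁ ⊕ ι₂) (A Φ ⊗ₜ Mf f))
  {f₀ : FinSB F (ι₁ ⊕ ι₂)} (hf₀ : Mf f₀ ≠ 0)
-- the two small implementers
variable (M₁ : piSchwartzBruhat F ι₁ ≃ₗ[ℂ] piSchwartzBruhat F ι₁)
  (hM₁ : Implements (adelicSchrodinger F ι₁ T₁) (ofSymplectic (polar (adelicForm F ι₁ T₁)) g₁) M₁)
  (A₁ : 𝓢((ι₁ → mixedSpace F), ℂ) ≃L[ℂ] 𝓢((ι₁ → mixedSpace F), ℂ)) (Mf₁ : FinSB F ι₁ →ₗ[ℂ] FinSB F ι₁)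
  (hAM₁ : ∀ (Φ : 𝓢((ι₁ → mixedSpace F), ℂ)) (f : FinSB F ι₁),
    M₁ (piSchwartzBruhatEquiv F ι₁ (Φ ⊗ₜ f)) = piSchwartzBruhatEquiv F ι₁ (A₁ Φ ⊗ₜ Mf₁ f))
  {f₁ : FinSB F ι₁} (hf₁ : Mf₁ f₁ ≠ 0)
  (M₂ : piSchwartzBruhat F ι₂ ≃ₗ[ℂ] piSchwartzBruhat F ι₂)
  (hM₂ : Implements (adelicSchrodinger F ι₂ T₂) (ofSymplectic (polar (adelicForm F ι₂ T₂)) g₂) M₂)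
  (A₂ : 𝓢((ι₂ → mixedSpace F), ℂ) ≃L[ℂ] 𝓢((ι₂ → mixedSpace F), ℂ)) (Mf₂ : FinSB F ι₂ →ₗ[ℂ] FinSB F ι₂)
  (hAM₂ : ∀ (Φ : 𝓢((ι₂ → mixedSpace F), ℂ)) (f : FinSB F ι₂),
    M₂ (piSchwartzBruhatEquiv F ι₂ (Φ ⊗ₜ f)) = piSchwartzBruhatEquiv F ι₂ (A₂ Φ ⊗ₜ Mf₂ f))
  {f₂ : FinSB F ι₂} (hf₂ : Mf₂ f₂ ≠ 0)

include hg hM hAM hf₀ in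
/-- **The big archimedean factor is projectively covariant over the block-diagonal phase-space map, with the product
cocycle** (all `(P, Q)`; `s_j = archPhaseMap`, `χ_j = archCocycle` of the two blocks). [cite: Folland1989, Prop. (1.43)] -/
theorem arch_covariant_rhoSD_block (P Q : (ι₁ × τ) ⊕ (ι₂ × τ) → ℝ) (Φ : 𝓢((ι₁ ⊕ ι₂ → mixedSpace F), ℂ)) :
    A (rhoSD (sumCarrierEquiv b ι₁ ι₂) P Q Φ) =
      blockChar (archCocycle T₁ (piCarrierEquiv b ι₁) hT₁ g₁) (archCocycle T₂ (piCarrierEquiv b ι₂) hT₂ g₂) (P, Q) •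
        rhoSD (sumCarrierEquiv b ι₁ ι₂)
          (blockPhase (archPhaseMap T₁ (piCarrierEquiv b ι₁) hT₁ g₁) (archPhaseMap T₂ (piCarrierEquiv b ι₂) hT₂ g₂)
            (P, Q)).1
          (blockPhase (archPhaseMap T₁ (piCarrierEquiv b ι₁) hT₁ g₁) (archPhaseMap T₂ (piCarrierEquiv b ι₂) hT₂ g₂)
            (P, Q)).2 (A Φ) := by
  -- write the two halves of `(P, Q)` in Folland coordinates of the blocks
  obtain ⟨⟨a₁, w₁⟩, h₁⟩ := (archFolland_bijective T₁ (piCarrierEquiv b ι₁) hT₁).2 (P ∘ Sum.inl, Q ∘ Sum.inl)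
  obtain ⟨⟨a₂, w₂⟩, h₂⟩ := (archFolland_bijective T₂ (piCarrierEquiv b ι₂) hT₂).2 (P ∘ Sum.inr, Q ∘ Sum.inr)
  have hp₁ := congrArg Prod.fst h₁
  have hq₁ := congrArg Prod.snd h₁
  have hp₂ := congrArg Prod.fst h₂
  have hq₂ := congrArg Prod.snd h₂
  simp only [archFolland_fst, archFolland_snd] at hp₁ hq₁ hp₂ hq₂
  -- the parametrised covariance of the big factor at `(Sum.elim a₁ a₂, Sum.elim w₁ w₂)`, split into blocks
  have hcov := arch_covariant_rhoSD_of_implements (Matrix.fromBlocks T₁ 0 0 T₂) (sumCarrierEquiv b ι₁ ι₂) G M hM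
    ((A : 𝓢((ι₁ ⊕ ι₂ → mixedSpace F), ℂ) →L[ℂ] 𝓢((ι₁ ⊕ ι₂ → mixedSpace F), ℂ)) :
      𝓢((ι₁ ⊕ ι₂ → mixedSpace F), ℂ) →ₗ[ℂ] 𝓢((ι₁ ⊕ ι₂ → mixedSpace F), ℂ)) Mf (fun Φ f => hAM Φ f) hf₀
    (Sum.elim a₁ a₂) (Sum.elim w₁ w₂) Φ
  simp only [follandCocycle_sumElim b T₁ T₂ G g₁ g₂ hg, archAct_sumElim T₁ T₂ G g₁ g₂ hg, archMat_fromBlocks,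
    fromBlocks_diag_mulVec_sumElim, sumCarrierEquiv_sumElim, follandFreq_sumElim] at hcov
  -- rewrite the goal through the same coordinates
  rw [← Sum.elim_comp_inl_inr P, ← Sum.elim_comp_inl_inr Q, blockChar_elim, blockPhase_elim, ← h₁, ← h₂,
    archCocycle_archFolland, archCocycle_archFolland, archPhaseMap_archFolland, archPhaseMap_archFolland,
    archFolland_fst, archFolland_fst, archFolland_snd, archFolland_snd, ← hp₁, ← hq₁, ← hp₂, ← hq₂]
  exact hcov

include b hT₁ hT₂ hg hM hAM hf₀ hM₁ hAM₁ hf₁ hM₂ hAM₂ hf₂ in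
/-- **THE ARCHIMEDEAN TWO-FACTOR THEOREM.** For implementing pairs `(G, M)`, `(g₁, M₁)`, `(g₂, M₂)` of a see-saw
configuration (`G` block-diagonal, `T = T₁ ⊕ T₂` with invertible archimedean parts) whose implementers are tensors
`A ⊗ M_f`, `A_j ⊗ M_{f,j}` on pure tensors with `A, A_j` continuous automorphisms and `M_f, M_{f,j}` nonzero, there is
ONE scalar `c ≠ 0` with `A (Φ₁ ⊠ Φ₂) = c • (A₁ Φ₁ ⊠ A₂ Φ₂)` for all archimedean Schwartz functions (`⊠ = archBoxTensor`).
[cite: Folland1989, Prop. (1.43)] -/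
theorem arch_two_factor :
    ∃ c : ℂ, c ≠ 0 ∧ ∀ (Φ₁ : 𝓢((ι₁ → mixedSpace F), ℂ)) (Φ₂ : 𝓢((ι₂ → mixedSpace F), ℂ)),
      A (archBoxTensor Φ₁ Φ₂) = c • archBoxTensor (A₁ Φ₁) (A₂ Φ₂) :=
  exists_ne_zero_smul_piBoxTensor_proj b (archCocycle_ne_zero T₁ (piCarrierEquiv b ι₁) hT₁ g₁)
    (archCocycle_ne_zero T₂ (piCarrierEquiv b ι₂) hT₂ g₂) A
    (arch_covariant_rhoSD_block b T₁ T₂ hT₁ hT₂ G g₁ g₂ hg M hM A Mf hAM hf₀) A₁ A₂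
    (fun p q f => arch_covariant_rhoSD_all T₁ (piCarrierEquiv b ι₁) hT₁ g₁ M₁ hM₁
      ((A₁ : 𝓢((ι₁ → mixedSpace F), ℂ) →L[ℂ] 𝓢((ι₁ → mixedSpace F), ℂ)) :
        𝓢((ι₁ → mixedSpace F), ℂ) →ₗ[ℂ] 𝓢((ι₁ → mixedSpace F), ℂ)) Mf₁ (fun Φ f => hAM₁ Φ f) hf₁ p q f)
    (fun p q f => arch_covariant_rhoSD_all T₂ (piCarrierEquiv b ι₂) hT₂ g₂ M₂ hM₂
      ((A₂ : 𝓢((ι₂ → mixedSpace F), ℂ) →L[ℂ] 𝓢((ι₂ → mixedSpace F), ℂ)) :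
        𝓢((ι₂ → mixedSpace F), ℂ) →ₗ[ℂ] 𝓢((ι₂ → mixedSpace F), ℂ)) Mf₂ (fun Φ f => hAM₂ Φ f) hf₂ p q f)

end TwoFactor

end Literature.NumberTheory.Weil1964

end
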